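import Summits.QuantumFields.BalabanUV.T4Continuum.Support.NE9PencilEndSharp
import Literature.MathematicalPhysics.QuantumFieldTheory.Balaban1983to89.T4HistoryLipschitzSegment

/-!
# NE9TwoPointKPOfPencilSharp — route R3′'s END-OF-RECORD path at one-activity constant 1: `‖w Q − w Q′‖ ≤ ‖Q − Q′‖·m/(R₀ − s₀)` along
# the input pencil (p248329 §1 has `4·…`), the bridge `TwoPointKP` with Lipschitz scale `1/(R₀ − s₀)` (p248329 §2: `4/(R₀ − s₀)`), and
# the END of record's pencil corollary at rate `ω + 4·(1/(R₀ − s₀))·B·τ̄` (p248329 §3: `ω + 4·(4/(R₀ − s₀))·B·τ̄`)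

Cell `pub-balaban`, T4-DAG §6 row NE9; NE9 crux team (coordinator ruling «YM REDIRECT» e34b3e0c (2)), leaf lineage
`b2b-balaban-t4-ne9-formalise-leaf-06` generation 39; route R3′ «pencil ∕ two-point KP» (co-lead of record, `t4/ROUTES-NE9.md` v6; refuter
`PRICING-NE9.md` v7.0.1 §C′).  SIBLING of the owner's bridge `NE9TwoPointKPOfPencil` (lineage `t4-ne9-p1` gen 58, p248329) and of the owner's
`NE9PencilEndSharp` (gen 60, p256040 = the refuter's stadium engine `StadiumKPSharp.rc0.lean` 75c899bddf747d93 filed: the SIBLING pencil END at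
constant 1, rate `ω + B·τ̄/(R₀ − s₀)`).  THIS FILE is the piece p256040 does not carry — the END-OF-RECORD twin (journal INTENT l.29033, NOTE
l.29138): the refuter's one-activity price check `SegmentCauchySharp.rc0.lean` 9273b595469ccfff (PRICING-NE9 v7 §C′(1),(3)(i): «the FIRST 4 is p248329
§1's near∕far split … removed to 1 … GLOBAL on the closed s₀-ball, no near∕far split, no new hypothesis») re-derived in eight lines from p256040's
`norm_sub_le_of_stadium` ∕ `ball_subset_stadium` (imported BY NAME, nothing restated), then threaded through p248329's §2∕§3 shapes.

THE POINT.  p248329 §1 bounds `‖w Q − w Q′‖` for a line-holomorphic `w` (`LineHolo`, :891 of `T4HistoryLipschitzActivity`) bounded by `m` on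
the ball `‖·‖ < R₀`, at tables `‖Q‖, ‖Q′‖ ≤ s₀ < R₀`, by `4/(R₀ − s₀)·‖Q − Q′‖·m` (Cauchy on the DISC of the pencil for near pairs, triangle
inequality for far pairs — a global-Lipschitz matching constant).  `LineHolo` places the pencil `z ↦ Q′ + z•(Q − Q′)` on its whole STADIUM
`{z ∣ Q′ + z•(Q − Q′) ∈ ball 0 R₀}`, which contains the disc of radius `(R₀ − s₀)/‖Q − Q′‖` about every point of `segment ℝ 0 1`
(`NE9PencilEndSharp.ball_subset_stadium`); the segment mean-value inequality with Cauchy's estimate on those discs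
(`NE9PencilEndSharp.norm_sub_le_of_stadium`) gives the constant ONE.  Fed into `T4HistoryLipschitzSegment.TwoPointKP` (§2) and its END (§3), the
END-of-record path's rate letter drops from `16·B·τ̄/(R₀ − s₀)` to `4·B·τ̄/(R₀ − s₀)` with NO new displayed input (refuter's letters: `b_rec =
16B/B₀ ↦ 4B/B₀`; the remaining `4` is `T4ActivityLipschitz.touchDiffSum_le_of_majorant`'s, inside the TwoPointKP architecture, NOT sharpened here).

HONEST FRAMING (T4-DAG PAGE 1).  Rung (B)+1 of the FINITE-VOLUME T⁴ programme — NOT infinite volume, NOT a mass gap, NOT the Clay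
problem.  NE9 (`T4OutputRate.NE9` ∧ `FadingMemory`) is a cell NEW ESTIMATE, NOT PRINTED in [II] = [Balaban1988RG2Cluster] (CMP **116**)
and NOT PROVED for Bałaban's E^{(j)} («NE9 ⇐ the named binders»; row WALLED ON A MODEL O-NE9-1; spine PROVED 0∕9); a sharper constant in a
CONDITIONAL END is not progress on the estimate itself.  HONEST DEPENDENCY (cell line, verbatim): continuum YM on T⁴ ⇐ BetaPertH ∧ nine
spine estimates (0/9 proved); BetaPertH ⇐ (D1) ∧ (D4) ∧ CAP+tail; G-an2-4 gates asym, D1 and NE2/3/4.  `FlowStep.BetaPertH`, (B), (B^μ) do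
not occur.  One-variable complex analysis and bookkeeping over ABSTRACT carriers; no `def`, no Prop-valued definition, no estimate of any
object of the series; [II] is referred to for TYPES only (ABSOLUTE RULE); every analytic input is a DISPLAYED binder with p248329's letters.  0 sorry.

* §1 [folklore] `isOpen_stadium`; **`norm_sub_le_of_lineHolo_ball_sharp`** — p248329 §1's binders VERBATIM ⊢ `‖w Q − w Q′‖ ≤ 1/(R₀ − s₀)·‖Q − Q′‖·m`
  (+ an `example`: the tree's constant-4 bound follows).
* §2 [folklore] **`twoPointKP_of_lineHolo_ball_sharp`** ∕ `twoPointKP_of_potentialKPG_sharp` — p248329 §2's binders VERBATIM ⊢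
  `TwoPointKP G W act 𝒜 m (fun _ ↦ 1/(R₀ − s₀)) a d`.
* §3 [folklore] **`ne9_and_fadingMemory_of_lineHolo_ball_perStep_sharp`** — p248329 §3's binder list VERBATIM (only `hpos` re-lettered) ⊢ NE9
  with the product moduli of rate `ω + 4·(1/(R₀ − s₀))·B·τ̄` and `FadingMemory` of the same rate (§2 ∘
  `T4HistoryLipschitzSegment.ne9_and_fadingMemory_of_twoPointKP_perStep`); `fade_iff_room_rec_sharp`: fading iff `4Bτ̄ < (R₀ − s₀)(1 − ω)`
  (p248329 `fade_iff_room`: `16Bτ̄ < …`; the sibling END's `NE9PencilEndSharp.fade_iff_room_sharp`: `Bτ̄ < …`).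
DISGUISE TEST: one complex variable + the bridge's bookkeeping; no history, no two couplings beyond the displayed binders; not NE9.
WHAT THIS DOES NOT DO: touches no activity, no species, no estimate of Bałaban's; (hhol)∕(hsup)∕(hkp2)∕(hocc) stay DISPLAYED; W1∕W2
(model O-NE9-1, (R-0)[scope] on the inflated box) untouched; which END the instancer feeds (END of record ∕ sibling END) and the display
`B/B₀` remain the owner's ∕ instancer's (PRICING-NE9 v7 §C′(4) NEEDS-CONSTANT, §H T13).

References (TYPES only): [Balaban1988RG2Cluster] T. Bałaban, Renormalization group approach to lattice gauge field theories. II.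
Cluster expansions, Commun. Math. Phys. **116** (1988) 1–22 — Lemma 3 (2.38) p. 20 over the tables of §2, (2.1) p. 12, (2.18) p. 16;
[KoteckyPreiss1986] R. Kotecký, D. Preiss, Commun. Math. Phys. **103** (1986) 491–498, (1)–(3).  Summits-side NEW work (LEAN
PLACEMENT RULE); imports the owner's `NE9PencilEndSharp` and `T4HistoryLipschitzSegment` BY NAME; modifies nothing; 0 sorry.  Value = route
R3′'s END-of-record rate constant `16 ↦ 4` with no new displayed input, NOT summit progress.  Engine credit: t4-ne9-refuter gen 7.
-/

namespace Summit.QuantumFields.BalabanUV.T4Continuum.NE9TwoPointKPOfPencilSharp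

open scoped BigOperators
open Metric Set
open Literature.Probability.LatticeModels
open Literature.MathematicalPhysics.QuantumFieldTheory.Balaban1983to89
open Literature.MathematicalPhysics.QuantumFieldTheory.Balaban1983to89.T4OutputRate
open Literature.MathematicalPhysics.QuantumFieldTheory.Balaban1983to89.T4HistoryLipschitzRecursion
open Literature.MathematicalPhysics.QuantumFieldTheory.Balaban1983to89.T4HistoryLipschitzOuter
open Literature.MathematicalPhysics.QuantumFieldTheory.Balaban1983to89.T4HistoryLipschitzActivity
open Literature.MathematicalPhysics.QuantumFieldTheory.Balaban1983to89.T4HistoryLipschitzSegment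
open Literature.MathematicalPhysics.QuantumFieldTheory.Balaban1983to89.T4HistoryLipschitzActivity (ClusterGeom)
open Summit.QuantumFields.BalabanUV.T4Continuum.NE9PencilEndSharp

/-! ## §1 One activity: the pencil bound with constant 1 -/

section OneActivity

variable {Pot : Type*} [NormedAddCommGroup Pot] [NormedSpace ℂ Pot]

/-- [folklore] The stadium `{z ∣ Q₀ + z•V ∈ ball 0 R₀}` of a complex line is open. -/
theorem isOpen_stadium (Q₀ V : Pot) (R₀ : ℝ) : IsOpen {z : ℂ | Q₀ + z • V ∈ ball (0 : Pot) R₀} :=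
  isOpen_ball.preimage (continuous_const.add (continuous_id.smul continuous_const))

/-- [folklore] **ONE-ACTIVITY PENCIL BOUND, CONSTANT 1** — the binders of `NE9TwoPointKPOfPencil.norm_sub_le_of_lineHolo_ball` (p248329 §1)
VERBATIM: `w` line-holomorphic on the ball `‖·‖ < R₀` (`LineHolo`), `‖w‖ ≤ m` there, `‖Q‖, ‖Q′‖ ≤ s₀ < R₀` ⇒
`‖w Q − w Q′‖ ≤ 1/(R₀ − s₀)·‖Q − Q′‖·m` (the tree's constant is `4/(R₀ − s₀)`): `NE9PencilEndSharp.norm_sub_le_of_stadium` on the pencil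
`z ↦ w (Q′ + z•(Q − Q′))` over its stadium, whose segment discs of radius `(R₀ − s₀)/‖Q − Q′‖` are supplied by
`NE9PencilEndSharp.ball_subset_stadium`.  The TYPE of the bound on the ball is [II] Lemma 3 (2.38) p. 20 read over the tables of [II] §2
(displayed by whoever instantiates, asserted nowhere).  Engine: t4-ne9-refuter g7 `SegmentCauchySharp.rc0.lean` 9273b595469ccfff. -/
theorem norm_sub_le_of_lineHolo_ball_sharp {w : Pot → ℂ} {m R₀ s₀ : ℝ} (hsR : s₀ < R₀) (hhol : LineHolo w R₀)
    (hm : ∀ Q ∈ ball (0 : Pot) R₀, ‖w Q‖ ≤ m) {Q Q' : Pot} (hQ : ‖Q‖ ≤ s₀) (hQ' : ‖Q'‖ ≤ s₀) :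
    ‖w Q - w Q'‖ ≤ 1 / (R₀ - s₀) * ‖Q - Q'‖ * m := by
  have hϱ : 0 < R₀ - s₀ := sub_pos.mpr hsR
  rcases (norm_nonneg (Q - Q')).eq_or_lt with h0 | hr
  · have hQQ : Q = Q' := sub_eq_zero.1 (norm_eq_zero.1 h0.symm)
    rw [hQQ, sub_self, norm_zero, sub_self, norm_zero, mul_zero, zero_mul]
  have hRpos : 0 < (R₀ - s₀) / ‖Q - Q'‖ := div_pos hϱ hr
  have key := norm_sub_le_of_stadium (f := fun z : ℂ => w (Q' + z • (Q - Q'))) (isOpen_stadium Q' (Q - Q') R₀) hRpos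
    (fun x hx => ball_subset_stadium hQ hQ' hr hx) (hhol Q' (Q - Q')) (fun z hz => hm _ hz)
  simp only [one_smul, zero_smul, add_zero, add_sub_cancel] at key
  calc ‖w Q - w Q'‖ ≤ m / ((R₀ - s₀) / ‖Q - Q'‖) := key
    _ = 1 / (R₀ - s₀) * ‖Q - Q'‖ * m := by rw [div_div_eq_mul_div]; field_simp

/-- [folklore] The tree's constant-4 bound `NE9TwoPointKPOfPencil.norm_sub_le_of_lineHolo_ball` (p248329 §1) is a COROLLARY of §1 (same
binders; an `example`, the landed declaration is not restated). -/
example {w : Pot → ℂ} {m R₀ s₀ : ℝ} (hsR : s₀ < R₀) (hhol : LineHolo w R₀)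
    (hm : ∀ Q ∈ ball (0 : Pot) R₀, ‖w Q‖ ≤ m) {Q Q' : Pot} (hQ : ‖Q‖ ≤ s₀) (hQ' : ‖Q'‖ ≤ s₀) :
    ‖w Q - w Q'‖ ≤ 4 / (R₀ - s₀) * ‖Q - Q'‖ * m := by
  have hϱ : 0 < R₀ - s₀ := sub_pos.mpr hsR
  have hm0 : 0 ≤ m := (norm_nonneg _).trans (hm Q' (mem_ball_zero_iff.2 (lt_of_le_of_lt hQ' hsR)))
  refine (norm_sub_le_of_lineHolo_ball_sharp hsR hhol hm hQ hQ').trans ?_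
  have h14 : 1 / (R₀ - s₀) ≤ 4 / (R₀ - s₀) := div_le_div_of_nonneg_right (by norm_num) hϱ.le
  exact mul_le_mul_of_nonneg_right (mul_le_mul_of_nonneg_right h14 (norm_nonneg _)) hm0

end OneActivity

/-! ## §2 The bridge with Lipschitz scale `1/(R₀ − s₀)` -/

section Bridge

variable {C : Carriers} (G : ClusterGeom C) {Bg : Type} {Pot : Type*} [NormedAddCommGroup Pot] [NormedSpace ℂ Pot]

/-- [folklore] **`TwoPointKP` FROM PENCIL DATA WITH LIPSCHITZ SCALE `1/(R₀ − s₀)`** — the binders of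
`NE9TwoPointKPOfPencil.twoPointKP_of_lineHolo_ball` (p248329 §2) VERBATIM: `a, d ≥ 0`, a room `s₀ < R₀`, admissible sets inside the closed
`s₀`-ball, and on the window at every occurring coupling ∕ background ∕ scale-(k+1) domain: line-holomorphy of every activity of the step
volume on the ball `‖Q‖ < R₀`, the bound `‖act Q γ‖ ≤ m γ` there (TYPE: [II] Lemma 3 (2.38) p. 20 over the tables of §2 — displayed by
whoever instantiates, asserted nowhere), the `d`-weighted KP inequality for `2m` ⇒ `TwoPointKP G W act 𝒜 m (fun _ ↦ 1/(R₀ − s₀)) a d`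
(the tree's scale is `4/(R₀ − s₀)`). -/
theorem twoPointKP_of_lineHolo_ball_sharp {W : Set (ℕ → ℝ)} {act : ℕ → ℝ → Bg → Pot → G.P → ℂ} {𝒜 : ℕ → Set Pot}
    {m : ℕ → ℝ → Bg → G.P → ℝ} {a d : G.P → ℝ} {R₀ s₀ : ℝ} (ha : ∀ γ, 0 ≤ a γ) (hd : ∀ γ, 0 ≤ d γ)
    (hsR : s₀ < R₀) (h𝒜 : ∀ k, 𝒜 k ⊆ closedBall (0 : Pot) s₀)
    (hhol : ∀ g ∈ W, ∀ (k : ℕ) (U : Bg) (X : C.Dom), C.scale X = k + 1 →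
      ∀ γ ∈ G.vol X, LineHolo (fun Q => act k (g k) U Q γ) R₀)
    (hsup : ∀ g ∈ W, ∀ (k : ℕ) (U : Bg) (X : C.Dom), C.scale X = k + 1 →
      ∀ Q ∈ ball (0 : Pot) R₀, ∀ γ ∈ G.vol X, ‖act k (g k) U Q γ‖ ≤ m k (g k) U γ)
    (hkp2 : ∀ g ∈ W, ∀ (k : ℕ) (U : Bg) (X : C.Dom), C.scale X = k + 1 →
      ∀ γ ∈ G.vol X, ∑ γ' ∈ G.vol X with G.inc γ' γ, 2 * m k (g k) U γ' * Real.exp (a γ' + d γ') ≤ a γ) :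
    TwoPointKP G W act 𝒜 m (fun _ => 1 / (R₀ - s₀)) a d := by
  have hϱ : 0 < R₀ - s₀ := sub_pos.mpr hsR
  refine ⟨ha, hd, fun _ => (div_pos one_pos hϱ).le, fun g hg k U X hX => ⟨?_, ?_, hkp2 g hg k U X hX⟩⟩
  · intro Q hQ γ hγ
    exact hsup g hg k U X hX Q
      (mem_ball_zero_iff.2 (lt_of_le_of_lt (mem_closedBall_zero_iff.1 (h𝒜 k hQ)) hsR)) γ hγ
  · intro Q hQ Q' hQ' γ hγ
    exact norm_sub_le_of_lineHolo_ball_sharp hsR (hhol g hg k U X hX γ hγ) (fun p hp => hsup g hg k U X hX p hp γ hγ)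
      (mem_closedBall_zero_iff.1 (h𝒜 k hQ)) (mem_closedBall_zero_iff.1 (h𝒜 k hQ'))

/-- [folklore] **`TwoPointKP` WITH SCALE `1/(R₀ − s₀)` FROM THE SIBLING'S PENCIL BINDER** `PotentialKPG W act m a d R₀` + the KP inequality
for `2m` + admissible sets inside `closedBall 0 s₀`, `s₀ < R₀` — the binders of `NE9TwoPointKPOfPencil.twoPointKP_of_potentialKPG`
VERBATIM. -/
theorem twoPointKP_of_potentialKPG_sharp {W : Set (ℕ → ℝ)} {act : ℕ → ℝ → Bg → Pot → G.P → ℂ} {𝒜 : ℕ → Set Pot}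
    {m : ℕ → ℝ → Bg → G.P → ℝ} {a d : G.P → ℝ} {R₀ s₀ : ℝ} (hK : G.PotentialKPG W act m a d R₀)
    (hsR : s₀ < R₀) (h𝒜 : ∀ k, 𝒜 k ⊆ closedBall (0 : Pot) s₀)
    (hkp2 : ∀ g ∈ W, ∀ (k : ℕ) (U : Bg) (X : C.Dom), C.scale X = k + 1 →
      ∀ γ ∈ G.vol X, ∑ γ' ∈ G.vol X with G.inc γ' γ, 2 * m k (g k) U γ' * Real.exp (a γ' + d γ') ≤ a γ) :
    TwoPointKP G W act 𝒜 m (fun _ => 1 / (R₀ - s₀)) a d := by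
  obtain ⟨ha, hd, hP⟩ := hK
  exact twoPointKP_of_lineHolo_ball_sharp G ha hd hsR h𝒜 (fun g hg k U X hX => (hP g hg k U X hX).1)
    (fun g hg k U X hX => (hP g hg k U X hX).2.1) hkp2

/-! ## §3 The END of record's pencil corollary at rate `ω + 4·(1/(R₀ − s₀))·B·τ̄` -/

/-- [folklore] **NE9 ∧ FADING MEMORY FROM PENCIL DATA THROUGH THE END OF RECORD'S ARCHITECTURE, ONE-ACTIVITY CONSTANT 1** — the binder list of
`NE9TwoPointKPOfPencil.ne9_and_fadingMemory_of_lineHolo_ball_perStep` (p248329 §3) VERBATIM, only `hpos` re-lettered to the new rate: §2 ∘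
`T4HistoryLipschitzSegment.ne9_and_fadingMemory_of_twoPointKP_perStep` with `𝒜 k := closedBall 0 s₀`, `lip k = lipbar := 1/(R₀ − s₀)` ⊢ NE9
with the product moduli of rate `ω + 4·(1/(R₀ − s₀))·B·τ̄` and `FadingMemory` of the same rate (the tree's is `ω + 4·(4/(R₀ − s₀))·B·τ̄`).
Every analytic input is a displayed binder (pencil data, channel data, decay extraction, pin budget, reading, occupation); nothing printed is
asserted. -/
theorem ne9_and_fadingMemory_of_lineHolo_ball_perStep_sharp {ι : Type} {E : Functional C Bg} {W : Set (ℕ → ℝ)}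
    {Adm : Set (Bg → C.Dom → ℝ)} {T : ℕ → (ℕ → ℝ) → (Bg → C.Dom → ℝ) → ι → ℝ}
    {Ψ : ℕ → ℝ → (ι → ℝ) → Bg → C.Dom → ℝ} {act : ℕ → ℝ → Bg → Pot → G.P → ℂ}
    {m : ℕ → ℝ → Bg → G.P → ℝ} {a d : G.P → ℝ} {δ : C.Dom → ℝ} {κ B ℓ τbar ω R₀ s₀ : ℝ}
    {wt : ℕ → ι → ℝ} {τ : ℕ → ℕ → ℝ} {lam : ℕ → ℝ} (ρ : ℕ → (ι → ℝ) → Pot) (h0 : ScaleZeroFree E W)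
    (hAdm : AdmissibleTerms E W Adm) (hres : AdmRestrict Adm) (hadd : ChannelAdditive Adm T)
    (hsum : ChannelStepSum Adm T) (hstep : ChannelSizeAtStepNN Adm T κ wt τ) (hfac : Factorises E W T Ψ)
    (hlast : LastCouplingLipschitz E W T Ψ κ lam) (ha : ∀ γ, 0 ≤ a γ) (hd : ∀ γ, 0 ≤ d γ) (hsR : s₀ < R₀)
    (hhol : ∀ g ∈ W, ∀ (k : ℕ) (U : Bg) (X : C.Dom), C.scale X = k + 1 →
      ∀ γ ∈ G.vol X, LineHolo (fun Q => act k (g k) U Q γ) R₀)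
    (hsup : ∀ g ∈ W, ∀ (k : ℕ) (U : Bg) (X : C.Dom), C.scale X = k + 1 →
      ∀ Q ∈ ball (0 : Pot) R₀, ∀ γ ∈ G.vol X, ‖act k (g k) U Q γ‖ ≤ m k (g k) U γ)
    (hkp2 : ∀ g ∈ W, ∀ (k : ℕ) (U : Bg) (X : C.Dom), C.scale X = k + 1 →
      ∀ γ ∈ G.vol X, ∑ γ' ∈ G.vol X with G.inc γ' γ, 2 * m k (g k) U γ' * Real.exp (a γ' + d γ') ≤ a γ)
    (hdec : G.DecayExtract δ d) (hpin : G.PinBudget a δ (fun _ => B) κ)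
    (hρ : ∀ (k : ℕ) (P P' : ι → ℝ) (M : ℝ), (∀ y, |P y - P' y| ≤ wt k y * M) → ‖ρ k P - ρ k P'‖ ≤ M)
    (hΨ : ∀ (k : ℕ) (s : ℝ) (P P' : ι → ℝ) (U : Bg) (X : C.Dom),
      Ψ k s P U X - Ψ k s P' U X = (G.newTerm act k s U X (ρ k P) - G.newTerm act k s U X (ρ k P')).re)
    (hocc : ∀ g ∈ W, ∀ g' ∈ W, ∀ k : ℕ, ‖ρ k (T k g' (E g))‖ ≤ s₀) (hℓ : 0 ≤ ℓ) (hB : 0 ≤ B)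
    (hτbar : 0 ≤ τbar) (hω : 0 ≤ ω) (hpos : 0 < ω + 4 * (1 / (R₀ - s₀)) * B * τbar)
    (hlam : ∀ k, lam k ≤ ℓ) (hτ : ∀ k j, j ≤ k → 0 ≤ τ k j ∧ τ k j ≤ τbar * ω ^ (k - j)) :
    NE9 E W κ (prodModuli ℓ fun _ => ω + 4 * (1 / (R₀ - s₀)) * B * τbar) ∧
      FadingMemory (ℓ / (ω + 4 * (1 / (R₀ - s₀)) * B * τbar)) (ω + 4 * (1 / (R₀ - s₀)) * B * τbar)
        (prodModuli ℓ fun _ => ω + 4 * (1 / (R₀ - s₀)) * B * τbar) :=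
  ne9_and_fadingMemory_of_twoPointKP_perStep G ρ h0 hAdm hres hadd hsum hstep hfac hlast
    (twoPointKP_of_lineHolo_ball_sharp G (𝒜 := fun _ => closedBall (0 : Pot) s₀) ha hd hsR (fun _ => Subset.rfl) hhol
      hsup hkp2)
    hdec hpin hρ hΨ (fun g hg g' hg' k => mem_closedBall_zero_iff.2 (hocc g hg g' hg' k)) hℓ hB (fun _ => le_rfl) hτbar
    hω hpos hlam hτ

omit [NormedSpace ℂ Pot] in
/-- [folklore] The rate of §3 fades iff `4·B·τ̄ < (R₀ − s₀)(1 − ω)` — p248329's `fade_iff_room` has `16·B·τ̄ < …`; the sibling pencil END's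
condition is `4Bτ̄ < …` at constant 4 (`T4HistoryLipschitzOuter.fade_of_radius`) and `Bτ̄ < …` at constant 1
(`NE9PencilEndSharp.fade_iff_room_sharp`, p256040). -/
theorem fade_iff_room_rec_sharp {ω B τbar R₀ s₀ : ℝ} (hsR : s₀ < R₀) :
    ω + 4 * (1 / (R₀ - s₀)) * B * τbar < 1 ↔ 4 * B * τbar < (R₀ - s₀) * (1 - ω) := by
  have hϱ : 0 < R₀ - s₀ := sub_pos.mpr hsR
  rw [show 4 * (1 / (R₀ - s₀)) * B * τbar = 4 * B * τbar / (R₀ - s₀) by ring]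
  constructor
  · intro h
    have h' : 4 * B * τbar / (R₀ - s₀) < 1 - ω := by linarith
    rwa [div_lt_iff₀ hϱ, mul_comm (1 - ω)] at h'
  · intro h
    have h' : 4 * B * τbar / (R₀ - s₀) < 1 - ω := by
      rw [div_lt_iff₀ hϱ, mul_comm (1 - ω)]; exact h
    linarith

end Bridge

end Summit.QuantumFields.BalabanUV.T4Continuum.NE9TwoPointKPOfPencilSharp
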